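import Literature.Analysis.FluidPDE.ChaeWolfDSSDecayLtNine
import Literature.Analysis.FluidPDE.CKNTenThirdsInterpolation
import Literature.Analysis.FluidPDE.ClassicalSuitable
import HarnessLib

/-!
# Chae–Wolf 2017, Theorem 1.1 — Step 4 for large exponents: `r⁻² ∫∫_{Q_r} |u|³ → 0` from the
# weighted Serrin estimate and the scale-invariant energy bound

Analysis/FluidPDE proofs file (theorems only; no definitions, no named facts) on the discharge
path of the named facts `Literature.Analysis.FluidPDE.chaeWolf2017_dss_typeI_decay_ge_nine` /
`Literature.Analysis.FluidPDE.chaeWolf2017_dss_typeI_decay` (D. Chae, J. Wolf, *Removing discretely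
self-similar singularities for the 3D Navier–Stokes equations*, Comm. PDE 42 (2017) =
arXiv:1610.09464, **Theorem 1.1**).

Step 4 of the printed proof (arXiv p. 6–7) shows `lim_{r→0} r⁻² ∫_{Q(z₀,r)} |u|³ = 0` at every top
point `z₀ = (x₀, 0)`, `x₀ ≠ 0`, from (2.11) — the weighted integral
`∫_{Q(z₀,ρ_k)} |u|^p (−t)^{(p−5)/2} → 0` — and the scale-invariant energy bound (2.17), via the
rescaled sequence `v_k`, the bound "`{v_k}` is bounded in `L^{10/3}(Q(0,R))`" and Vitali's
theorem. The tree's `tendsto_cknC_zero_of_weighted_lt_top` (`ChaeWolfDSSDecayLtNine.lean`) does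
this by a single Hölder inequality against the weight, which only works for `p < 9`. Here the
**same two inputs** — the weighted integral and the `L^{10/3}` bound — are combined by ONE
three-exponent Hölder inequality instead of the compactness argument:

`|u|³ = (|u|^p w)^{1/(3p)} · (|u|^{10/3})^{4/5} · (w^{−μ})^{δ}`, `w = (−t)^{(p−5)/2}`,
`δ = (3p−5)/(15p)`, `μ = 5(p−5)/(2(3p−5)) < 1`,

so that, with `∬_{Q_r}|u|^{10/3} ≤ K r^{5/3} A^{2/3}(A + E)` (Lemarié-Rieusset (13.18), the tree's
`exists_lintegral_tenThirds_backward_le`) and `A(r), E(r) ≤ Λ` at `z₀` (file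
`ChaeWolfDSSUniformEnergy.lean`), the exponents of `r` add up to exactly `2`
(`(r^{5/3})^{4/5} (r³(r²)^{1−μ})^{δ} = r²`) and `C(r) ≤ K' (∬_{Q_r}|u|^p w)^{1/(3p)} → 0`:

* `lintegral_cube_le_weighted_tenThirds` — the Hölder inequality on `Q_r(0, x₀)`, `p ≥ 9`;
* `tendsto_cknC_zero_of_weighted_lt_top_of_energy` — **Step 4's conclusion for `p ≥ 9`**.

## References

* D. Chae, J. Wolf, arXiv:1610.09464, §2 Step 4, (2.9)–(2.18) and "lim_{r→0} r⁻²∫_{Q(z₀,r)}|u|³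
  = 0" (p. 6–7). [ChaeWolf2017RemovingDSS]
* P. G. Lemarié-Rieusset, *The Navier–Stokes problem in the 21st century* (2016), §13.9,
  (13.18). [LemarieRieusset2016]
-/

noncomputable section

open MeasureTheory TopologicalSpace Set Function Filter Metric
open _root_.Topology
open scoped ENNReal NNReal

namespace Literature.Analysis.FluidPDE

namespace ChaeWolfDecay

variable {u : ℝ → EuclideanSpace ℝ (Fin 3) → EuclideanSpace ℝ (Fin 3)}

/-! ### Step 4 for `q ≥ 9`: Hölder with three exponents -/

section CubicAllQ

/-- The exponent bookkeeping: `(r^{5/3})^{4/5} · (r³ (r²)^{1−μ})^{δ} = r²` with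
`μ = 5(q−5)/(2(3q−5))`, `δ = (3q−5)/(15q)` (`q ≥ 9`, `r > 0`). [folklore] -/
private theorem cubic_exponent_identity_tenThirds {q : ℝ} (hq : 9 ≤ q) {r : ℝ} (hr : 0 < r) :
    (r ^ (5 / 3 : ℝ)) ^ (4 / 5 : ℝ) *
      (r ^ 3 * (r ^ 2) ^ (1 - 5 * (q - 5) / (2 * (3 * q - 5)))) ^ ((3 * q - 5) / (15 * q)) =
        r ^ 2 := by
  set μ : ℝ := 5 * (q - 5) / (2 * (3 * q - 5)) with hμ
  set δ : ℝ := (3 * q - 5) / (15 * q) with hδ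
  have hq0 : q ≠ 0 := by linarith
  have h3q5 : 3 * q - 5 ≠ 0 := by linarith
  have h2 : 2 * (3 * q - 5) ≠ 0 := by linarith
  have e1 : r ^ 3 * (r ^ 2) ^ (1 - μ) = r ^ (5 - 2 * μ) := by
    rw [← Real.rpow_natCast r 3, ← Real.rpow_natCast r 2, ← Real.rpow_mul hr.le,
      ← Real.rpow_add hr]
    congr 1; push_cast; ring
  rw [e1, ← Real.rpow_mul hr.le, ← Real.rpow_mul hr.le, ← Real.rpow_add hr]
  have e2 : (5 / 3 : ℝ) * (4 / 5) + (5 - 2 * μ) * δ = 2 := by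
    rw [hμ, hδ]; field_simp; ring
  rw [e2]
  exact_mod_cast Real.rpow_natCast r 2

/-- **Hölder's inequality with three exponents on a backward cylinder** (the quantitative form of
Chae–Wolf's Step 4 for `p ≥ 9`). For `q ≥ 9`, `u` jointly continuous below `t = 0` and a cylinder
`Q_r(0, x₀)`:
`∫∫_{Q_r} |u|³ ≤ (∫∫_{Q_r} |u|^q (−t)^{(q−5)/2})^{1/(3q)} · (∫∫_{Q_r} |u|^{10/3})^{4/5} ·
(|B_r| (r²)^{1−μ}/(1−μ))^{δ}`, `δ = (3q−5)/(15q)`, `μ = 5(q−5)/(2(3q−5))`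
(pointwise `|u|³ = (|u|^q w)^{1/(3q)} (|u|^{10/3})^{4/5} (w^{−μ})^{δ}`, `w = (−t)^{(q−5)/2}`).
[cite: ChaeWolf2017RemovingDSS, §2 Step 4, (2.11)–(2.18) (arXiv p. 6–7)] -/
theorem lintegral_cube_le_weighted_tenThirds (hcont : ContinuousOn (uncurry u) (Iio 0 ×ˢ univ))
    {q : ℝ} (hq : 9 ≤ q) (x₀ : EuclideanSpace ℝ (Fin 3)) {r : ℝ} (hr : 0 < r) :
    ∫⁻ z in parabolicCylinder r ((0 : ℝ), x₀), ‖u z.1 z.2‖ₑ ^ (3 : ℕ) ≤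
      (∫⁻ z in parabolicCylinder r ((0 : ℝ), x₀),
          ‖u z.1 z.2‖ₑ ^ q * ENNReal.ofReal ((-z.1) ^ ((q - 5) / 2))) ^ (1 / (3 * q)) *
      (∫⁻ z in parabolicCylinder r ((0 : ℝ), x₀), ‖u z.1 z.2‖ₑ ^ (10 / 3 : ℝ)) ^ (4 / 5 : ℝ) *
      (volume (ball x₀ r) * ENNReal.ofReal ((r ^ 2) ^ (1 - 5 * (q - 5) / (2 * (3 * q - 5))) /
        (1 - 5 * (q - 5) / (2 * (3 * q - 5))))) ^ ((3 * q - 5) / (15 * q)) := by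
  -- exponents
  have hq0 : 0 < q := by linarith
  set e₁ : ℝ := (q - 5) / 2 with he₁
  set α : ℝ := 1 / (3 * q) with hα
  set β : ℝ := 4 / 5 with hβ
  set δ : ℝ := (3 * q - 5) / (15 * q) with hδ
  set μ : ℝ := 5 * (q - 5) / (2 * (3 * q - 5)) with hμ
  have h3q5 : 0 < 3 * q - 5 := by linarith
  have hα0 : 0 < α := by positivity
  have hα1 : α < 1 := by rw [hα, div_lt_one (by positivity)]; linarith
  have h1α : 0 < 1 - α := by linarith
  have hβ0 : 0 ≤ β := by norm_num
  have hδ0 : 0 < δ := by positivity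
  have hβδ : β + δ = 1 - α := by rw [hα, hβ, hδ]; field_simp; ring
  have he₁0 : 0 ≤ e₁ := by rw [he₁]; exact div_nonneg (by linarith) (by norm_num)
  have hμ1 : μ < 1 := by rw [hμ, div_lt_one (by positivity)]; linarith
  have h3q5' : 3 * q - 5 ≠ 0 := h3q5.ne'
  have hq0' : q ≠ 0 := hq0.ne'
  have hμδ : μ * δ = e₁ * α := by
    rw [hμ, hδ, he₁, hα, div_mul_div_comm, div_mul_div_comm, div_eq_div_iff (by positivity)
      (by positivity)]
    ring
  set β' : ℝ := β / (1 - α) with hβ'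
  set δ' : ℝ := δ / (1 - α) with hδ'
  have hβ'0 : 0 ≤ β' := by positivity
  have hδ'0 : 0 ≤ δ' := by positivity
  have hβ'δ' : β' + δ' = 1 := by
    rw [hβ', hδ', ← add_div, hβδ, div_self h1α.ne']
  have hβ'1 : β' * (1 - α) = β := by rw [hβ']; field_simp
  have hδ'1 : δ' * (1 - α) = δ := by rw [hδ']; field_simp
  -- the cylinder
  set Q : Set (ℝ × EuclideanSpace ℝ (Fin 3)) := parabolicCylinder r ((0 : ℝ), x₀) with hQ
  have hQm : MeasurableSet Q := (isOpen_parabolicCylinder _ _).measurableSet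
  have hQsub : Q ⊆ Iio 0 ×ˢ univ := fun z hz => by
    rw [hQ, mem_parabolicCylinder] at hz
    exact ⟨(hz.1.2 : z.1 < 0), mem_univ _⟩
  have hneg : ∀ z ∈ Q, 0 < -z.1 := fun z hz => by
    have := (hQsub hz).1; simp only [mem_Iio] at this; linarith
  set ν : Measure (ℝ × EuclideanSpace ℝ (Fin 3)) := volume.restrict Q with hν
  -- the three functions
  set W : ℝ × EuclideanSpace ℝ (Fin 3) → ℝ≥0∞ := fun z => ENNReal.ofReal (-z.1) with hW
  have hWm : Measurable W := ENNReal.measurable_ofReal.comp (measurable_fst.neg)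
  have hW0 : ∀ z ∈ Q, W z ≠ 0 := fun z hz => (ENNReal.ofReal_pos.2 (hneg z hz)).ne'
  have hWt : ∀ z, W z ≠ ⊤ := fun z => ENNReal.ofReal_ne_top
  set N : ℝ × EuclideanSpace ℝ (Fin 3) → ℝ≥0∞ := fun z => ‖u z.1 z.2‖ₑ with hN
  have hNm : AEMeasurable N ν :=
    ((hcont.mono hQsub).aestronglyMeasurable hQm).enorm
  set f₁ : ℝ × EuclideanSpace ℝ (Fin 3) → ℝ≥0∞ := fun z => N z ^ q * W z ^ e₁ with hf₁
  set f₂ : ℝ × EuclideanSpace ℝ (Fin 3) → ℝ≥0∞ := fun z => N z ^ (10 / 3 : ℝ) with hf₂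
  set f₃ : ℝ × EuclideanSpace ℝ (Fin 3) → ℝ≥0∞ := fun z => W z ^ (-μ) with hf₃
  set G : ℝ × EuclideanSpace ℝ (Fin 3) → ℝ≥0∞ := fun z => f₂ z ^ β' * f₃ z ^ δ' with hG
  have hf₁m : AEMeasurable f₁ ν := (hNm.pow_const q).mul (hWm.pow_const e₁).aemeasurable
  have hf₂m : AEMeasurable f₂ ν := hNm.pow_const _
  have hf₃m : AEMeasurable f₃ ν := (hWm.pow_const (-μ)).aemeasurable
  have hGm : AEMeasurable G ν := (hf₂m.pow_const β').mul (hf₃m.pow_const δ')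
  -- Hölder, twice
  have hB := ENNReal.lintegral_mul_norm_pow_le hf₂m hf₃m hβ'0 hδ'0 hβ'δ'
  have hA := ENNReal.lintegral_mul_norm_pow_le hf₁m hGm hα0.le h1α.le (by ring)
  -- the integrand on `Q`
  have hpt : ∀ z ∈ Q, f₁ z ^ α * G z ^ (1 - α) = ‖u z.1 z.2‖ₑ ^ (3 : ℕ) := by
    intro z hz
    have hG' : G z ^ (1 - α) = N z ^ ((10 / 3 : ℝ) * β) * W z ^ (-μ * δ) := by
      show (f₂ z ^ β' * f₃ z ^ δ') ^ (1 - α) = _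
      rw [ENNReal.mul_rpow_of_nonneg _ _ h1α.le]
      have a1 : (f₂ z ^ β') ^ (1 - α) = N z ^ ((10 / 3 : ℝ) * β) := by
        rw [← ENNReal.rpow_mul, hβ'1]
        show (N z ^ (10 / 3 : ℝ)) ^ β = _
        rw [← ENNReal.rpow_mul]
      have a2 : (f₃ z ^ δ') ^ (1 - α) = W z ^ (-μ * δ) := by
        rw [← ENNReal.rpow_mul, hδ'1]
        show (W z ^ (-μ)) ^ δ = _
        rw [← ENNReal.rpow_mul]
      rw [a1, a2]
    have hf₁' : f₁ z ^ α = N z ^ (q * α) * W z ^ (e₁ * α) := by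
      show (N z ^ q * W z ^ e₁) ^ α = _
      rw [ENNReal.mul_rpow_of_nonneg _ _ hα0.le, ← ENNReal.rpow_mul, ← ENNReal.rpow_mul]
    rw [hG', hf₁']
    have hNexp : q * α + 10 / 3 * β = 3 := by rw [hα, hβ]; field_simp; ring
    have hWexp : e₁ * α + -μ * δ = 0 := by rw [neg_mul, hμδ]; ring
    calc N z ^ (q * α) * W z ^ (e₁ * α) * (N z ^ ((10 / 3 : ℝ) * β) * W z ^ (-μ * δ))
        = (N z ^ (q * α) * N z ^ ((10 / 3 : ℝ) * β)) * (W z ^ (e₁ * α) * W z ^ (-μ * δ)) := by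
          ring
      _ = N z ^ (q * α + 10 / 3 * β) * W z ^ (e₁ * α + -μ * δ) := by
          rw [ENNReal.rpow_add_of_nonneg _ _ (by positivity) (by positivity),
            ENNReal.rpow_add _ _ (hW0 z hz) (hWt z)]
      _ = ‖u z.1 z.2‖ₑ ^ (3 : ℕ) := by
          rw [hNexp, hWexp, ENNReal.rpow_zero, mul_one, hN]
          exact_mod_cast ENNReal.rpow_natCast (‖u z.1 z.2‖ₑ) 3
  have e_lhs : ∫⁻ z in Q, ‖u z.1 z.2‖ₑ ^ (3 : ℕ) = ∫⁻ z, f₁ z ^ α * G z ^ (1 - α) ∂ν :=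
    (setLIntegral_congr_fun hQm fun z hz => hpt z hz).symm
  -- the first integral is the weighted one
  have e_f₁ : ∫⁻ z, f₁ z ∂ν = ∫⁻ z in Q, ‖u z.1 z.2‖ₑ ^ q * ENNReal.ofReal ((-z.1) ^ ((q - 5) / 2)) := by
    refine setLIntegral_congr_fun hQm fun z hz => ?_
    show N z ^ q * W z ^ e₁ = _
    rw [hW, ENNReal.ofReal_rpow_of_pos (hneg z hz)]
  -- the third integral: the time factor
  have e_f₃ : ∫⁻ z, f₃ z ∂ν = volume (ball x₀ r) * ENNReal.ofReal ((r ^ 2) ^ (1 - μ) / (1 - μ)) := by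
    have hvol : (volume : Measure (ℝ × (EuclideanSpace ℝ (Fin 3)))) =
        (volume : Measure ℝ).prod (volume : Measure (EuclideanSpace ℝ (Fin 3))) := rfl
    have hm : AEMeasurable (fun z : ℝ × EuclideanSpace ℝ (Fin 3) => W z ^ (-μ))
        ((volume.restrict (Ioo (0 - r ^ 2) 0)).prod (volume.restrict (ball x₀ r))) :=
      (hWm.pow_const (-μ)).aemeasurable
    show ∫⁻ z in Q, W z ^ (-μ) = _
    rw [hQ, parabolicCylinder, hvol, ← Measure.prod_restrict, lintegral_prod _ hm]
    simp only [hW]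
    have hmeas' : Measurable fun x : ℝ => ENNReal.ofReal (-x) ^ (-μ) :=
      (ENNReal.measurable_ofReal.comp measurable_neg).pow_const (-μ)
    rw [show (fun x : ℝ => ∫⁻ _ in ball x₀ r, ENNReal.ofReal (-x) ^ (-μ) ∂volume) =
        fun x : ℝ => ENNReal.ofReal (-x) ^ (-μ) * volume (ball x₀ r) from by
          funext x; rw [setLIntegral_const],
      lintegral_mul_const _ hmeas', lintegral_Ioo_rpow_neg hμ1 hr, mul_comm]
  -- assemble
  rw [e_lhs]
  refine hA.trans ?_
  rw [e_f₁]
  have hG_le : (∫⁻ z, G z ∂ν) ^ (1 - α) ≤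
      (∫⁻ z, f₂ z ∂ν) ^ β * (∫⁻ z, f₃ z ∂ν) ^ δ := by
    calc (∫⁻ z, G z ∂ν) ^ (1 - α)
        ≤ ((∫⁻ z, f₂ z ∂ν) ^ β' * (∫⁻ z, f₃ z ∂ν) ^ δ') ^ (1 - α) :=
          ENNReal.rpow_le_rpow hB h1α.le
      _ = (∫⁻ z, f₂ z ∂ν) ^ β * (∫⁻ z, f₃ z ∂ν) ^ δ := by
          rw [ENNReal.mul_rpow_of_nonneg _ _ h1α.le, ← ENNReal.rpow_mul, ← ENNReal.rpow_mul,
            hβ'1, hδ'1]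
  calc (∫⁻ z in Q, ‖u z.1 z.2‖ₑ ^ q * ENNReal.ofReal ((-z.1) ^ ((q - 5) / 2))) ^ α *
        (∫⁻ z, G z ∂ν) ^ (1 - α)
      ≤ (∫⁻ z in Q, ‖u z.1 z.2‖ₑ ^ q * ENNReal.ofReal ((-z.1) ^ ((q - 5) / 2))) ^ α *
          ((∫⁻ z, f₂ z ∂ν) ^ β * (∫⁻ z, f₃ z ∂ν) ^ δ) := by gcongr
    _ = _ := by rw [e_f₃, hβ, ← mul_assoc]

/-- **Step 4 for `q ≥ 9`: `r⁻² ∫∫_{Q(z₀,r)} |u|³ → 0`** at a top point `z₀ = (0, x₀)` whose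
spatial neighbourhood `B(x₀, ρ)` lies in a region `D` where the weighted Serrin integral of
Step 3 is finite, `∫_{−∞}^0 ∫_D |u|^q (−t)^{(q−5)/2} < ∞`, GIVEN the scale-invariant energy bound
`A(r; z₀), E(r; z₀) ≤ Λ` for `0 < r ≤ ρ` ((2.17); `cknAEss`, `cknE` with `G = ∇u`): by
`lintegral_cube_le_weighted_tenThirds` and `∬_{Q_r}|u|^{10/3} ≤ K r^{5/3} A^{2/3}(A + E)`,
`C(r) ≤ K' (∫∫_{Q_r} |u|^q (−t)^{(q−5)/2})^{1/(3q)}`, and the right-hand side tends to `0` with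
`|Q_r|` (absolute continuity of the integral). This replaces the printed compactness argument
("`{v_k}` is bounded in `L^{10/3}(Q(0,R))` … Vitali's convergence theorem … (2.18)").
[cite: ChaeWolf2017RemovingDSS, §2 Step 4, (2.11), (2.17), (2.18) (arXiv p. 6–7)] -/
theorem tendsto_cknC_zero_of_weighted_lt_top_of_energy
    (hu1 : ContDiffOn ℝ 1 (uncurry u) (Iio 0 ×ˢ univ))
    {D : Set (EuclideanSpace ℝ (Fin 3))} {q : ℝ} (hq : 9 ≤ q)
    (hfin : ∫⁻ z in Iio (0 : ℝ) ×ˢ D, ‖u z.1 z.2‖ₑ ^ q * ENNReal.ofReal ((-z.1) ^ ((q - 5) / 2)) < ⊤)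
    (x₀ : EuclideanSpace ℝ (Fin 3)) {ρ : ℝ} (hρ : 0 < ρ) (hball : ball x₀ ρ ⊆ D)
    {Λ : ℝ≥0} (hA : ∀ r ∈ Ioc 0 ρ, cknAEss r ((0 : ℝ), x₀) u ≤ Λ)
    (hE : ∀ r ∈ Ioc 0 ρ, cknE r ((0 : ℝ), x₀) (fun t x => fderiv ℝ (u t) x) ≤ Λ) :
    Tendsto (fun r => cknC r ((0 : ℝ), x₀) u) (𝓝[>] 0) (𝓝 0) := by
  have hq0 : 0 < q := by linarith
  have hcont : ContinuousOn (uncurry u) (Iio 0 ×ˢ univ) := hu1.continuousOn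
  set μ : ℝ := 5 * (q - 5) / (2 * (3 * q - 5)) with hμ
  set δ : ℝ := (3 * q - 5) / (15 * q) with hδ
  set α : ℝ := 1 / (3 * q) with hα
  have h3q5 : 0 < 3 * q - 5 := by linarith
  have hμ1 : μ < 1 := by rw [hμ, div_lt_one (by positivity)]; linarith
  have h1μ : 0 < 1 - μ := by linarith
  have hδ0 : 0 < δ := by positivity
  have hα0 : 0 < α := by positivity
  set F : ℝ × EuclideanSpace ℝ (Fin 3) → ℝ≥0∞ := fun z =>
    ‖u z.1 z.2‖ₑ ^ q * ENNReal.ofReal ((-z.1) ^ ((q - 5) / 2)) with hF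
  -- the `L^{10/3}` constant and the assembled constant
  obtain ⟨K, hK⟩ := exists_lintegral_tenThirds_backward_le
  set K₂ : ℝ≥0∞ := K * (Λ : ℝ≥0∞) ^ (2 / 3 : ℝ) * ((Λ : ℝ≥0∞) + Λ) with hK₂
  have hK₂t : K₂ ≠ ⊤ := by
    refine ENNReal.mul_ne_top (ENNReal.mul_ne_top ENNReal.coe_ne_top
      (ENNReal.rpow_ne_top_of_nonneg (by norm_num) ENNReal.coe_ne_top)) ?_
    exact ENNReal.add_ne_top.2 ⟨ENNReal.coe_ne_top, ENNReal.coe_ne_top⟩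
  set V₁ : ℝ := ((volume : Measure (EuclideanSpace ℝ (Fin 3))) (ball 0 1)).toReal with hV₁
  have hV₁0 : 0 ≤ V₁ := ENNReal.toReal_nonneg
  set Kc : ℝ≥0∞ := K₂ ^ (4 / 5 : ℝ) * ENNReal.ofReal ((V₁ / (1 - μ)) ^ δ) with hKc
  have hKct : Kc ≠ ⊤ :=
    ENNReal.mul_ne_top (ENNReal.rpow_ne_top_of_nonneg (by norm_num) hK₂t) ENNReal.ofReal_ne_top
  set ν : Measure (ℝ × EuclideanSpace ℝ (Fin 3)) := volume.restrict (Iio (0 : ℝ) ×ˢ D) with hν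
  -- cylinders of radius `≤ ρ` lie in `(−∞,0) × D`
  have hsub : ∀ r ∈ Ioc 0 ρ, parabolicCylinder r ((0 : ℝ), x₀) ⊆ Iio (0 : ℝ) ×ˢ D := by
    intro r hr z hz
    rw [mem_parabolicCylinder] at hz
    exact ⟨(hz.1.2 : z.1 < 0), hball ((ball_subset_ball hr.2) (by simpa using hz.2))⟩
  -- `I(r) = ∫∫_{Q_r} F → 0`
  have hvol_tend : Tendsto (fun r : ℝ => ν (parabolicCylinder r ((0 : ℝ), x₀))) (𝓝[>] 0) (𝓝 0) := by
    have hle : ∀ r ∈ Ioi (0 : ℝ), ν (parabolicCylinder r ((0 : ℝ), x₀)) ≤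
        ENNReal.ofReal (r ^ 2) * volume (ball x₀ r) := by
      intro r hr
      calc ν (parabolicCylinder r ((0 : ℝ), x₀)) ≤ volume (parabolicCylinder r ((0 : ℝ), x₀)) :=
            Measure.restrict_apply_le _ _
        _ = volume (Ioo ((0 : ℝ) - r ^ 2) 0) * volume (ball x₀ r) := by
            rw [parabolicCylinder, Measure.volume_eq_prod, Measure.prod_prod]
        _ = ENNReal.ofReal (r ^ 2) * volume (ball x₀ r) := by rw [Real.volume_Ioo]; ring_nf
    have h0 : Tendsto (fun r : ℝ => ENNReal.ofReal (r ^ 2) * volume (ball x₀ r)) (𝓝[>] 0) (𝓝 0) := by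
      have h1 : Tendsto (fun r : ℝ => ENNReal.ofReal (r ^ 2)) (𝓝[>] 0) (𝓝 0) := by
        have : Tendsto (fun r : ℝ => r ^ 2) (𝓝[>] (0:ℝ)) (𝓝 0) := by
          have h := tendsto_nhdsWithin_of_tendsto_nhds (s := Ioi (0:ℝ)) ((continuous_pow 2).tendsto (0:ℝ))
          simpa using h
        simpa using ENNReal.tendsto_ofReal this
      have h2 : ∀ r ∈ Ioo (0 : ℝ) ρ, volume (ball x₀ r) ≤ volume (ball x₀ ρ) := fun r hr =>
        measure_mono (ball_subset_ball hr.2.le)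
      have hfinρ : volume (ball x₀ ρ) ≠ ⊤ := (measure_ball_lt_top).ne
      have h3 : Tendsto (fun r : ℝ => ENNReal.ofReal (r ^ 2) * volume (ball x₀ ρ)) (𝓝[>] 0) (𝓝 0) := by
        have := ENNReal.Tendsto.mul_const h1 (Or.inr hfinρ)
        rwa [zero_mul] at this
      refine tendsto_of_tendsto_of_tendsto_of_le_of_le' tendsto_const_nhds h3
        (Eventually.of_forall fun r => zero_le) ?_
      filter_upwards [Ioo_mem_nhdsGT hρ] with r hr
      exact mul_le_mul' le_rfl (h2 r hr)
    refine tendsto_of_tendsto_of_tendsto_of_le_of_le' tendsto_const_nhds h0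
      (Eventually.of_forall fun r => zero_le) ?_
    filter_upwards [self_mem_nhdsWithin] with r hr using hle r hr
  have hI : Tendsto (fun r : ℝ => ∫⁻ z in parabolicCylinder r ((0 : ℝ), x₀), F z ∂ν) (𝓝[>] 0) (𝓝 0) :=
    tendsto_setLIntegral_zero (by rw [hν]; exact hfin.ne) hvol_tend
  have hI' : Tendsto (fun r : ℝ => ∫⁻ z in parabolicCylinder r ((0 : ℝ), x₀), F z) (𝓝[>] 0) (𝓝 0) := by
    refine hI.congr' ?_
    filter_upwards [Ioc_mem_nhdsGT hρ] with r hr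
    rw [hν, Measure.restrict_restrict (isOpen_parabolicCylinder _ _).measurableSet,
      inter_eq_left.2 (hsub r hr)]
  -- the `L^{10/3}` bound on `Q_r(0, x₀)`, `r ≤ ρ`
  have h103 : ∀ r ∈ Ioc 0 ρ, ∫⁻ z in parabolicCylinder r ((0 : ℝ), x₀), ‖u z.1 z.2‖ₑ ^ (10 / 3 : ℝ) ≤
      K₂ * ENNReal.ofReal (r ^ (5 / 3 : ℝ)) := by
    intro r hr
    have hQsub : ((parabolicCylinderOpens r ((0 : ℝ), x₀) : Opens (ℝ × EuclideanSpace ℝ (Fin 3))) :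
        Set (ℝ × EuclideanSpace ℝ (Fin 3))) ⊆ Iio (0 : ℝ) ×ˢ univ := by
      intro z hz
      simp only [coe_parabolicCylinderOpens, mem_parabolicCylinder] at hz
      exact ⟨(hz.1.2 : z.1 < 0), mem_univ _⟩
    have hwg : HasWeakSpatialGradientOn (parabolicCylinderOpens r ((0 : ℝ), x₀)) u
        (fun t x => fderiv ℝ (u t) x) := hasWeakSpatialGradientOn_of_contDiffOn isOpen_Iio hQsub hu1
    have hAt : cknAEss r ((0 : ℝ), x₀) u ≠ ∞ := ne_top_of_le_ne_top ENNReal.coe_ne_top (hA r hr)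
    have hEt : cknE r ((0 : ℝ), x₀) (fun t x => fderiv ℝ (u t) x) ≠ ∞ :=
      ne_top_of_le_ne_top ENNReal.coe_ne_top (hE r hr)
    refine (hK u _ ((0 : ℝ), x₀) r hr.1 hwg hAt hEt).trans ?_
    rw [hK₂]
    calc (K : ℝ≥0∞) * ENNReal.ofReal (r ^ (5 / 3 : ℝ)) * cknAEss r ((0 : ℝ), x₀) u ^ (2 / 3 : ℝ) *
          (cknAEss r ((0 : ℝ), x₀) u + cknE r ((0 : ℝ), x₀) (fun t x => fderiv ℝ (u t) x))
        ≤ (K : ℝ≥0∞) * ENNReal.ofReal (r ^ (5 / 3 : ℝ)) * (Λ : ℝ≥0∞) ^ (2 / 3 : ℝ) *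
            ((Λ : ℝ≥0∞) + Λ) := by
          gcongr
          · exact hA r hr
          · exact hA r hr
          · exact hE r hr
      _ = (K : ℝ≥0∞) * (Λ : ℝ≥0∞) ^ (2 / 3 : ℝ) * ((Λ : ℝ≥0∞) + Λ) * ENNReal.ofReal (r ^ (5 / 3 : ℝ)) := by
          ring
  -- the bound `C(r) ≤ Kc I(r)^{α}`
  have hbound : ∀ r ∈ Ioc 0 ρ, cknC r ((0 : ℝ), x₀) u ≤
      Kc * (∫⁻ z in parabolicCylinder r ((0 : ℝ), x₀), F z) ^ α := by
    intro r hr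
    have hr0 := hr.1
    have key := lintegral_cube_le_weighted_tenThirds hcont hq x₀ hr0
    -- the second and third factors
    have h2 : (∫⁻ z in parabolicCylinder r ((0 : ℝ), x₀), ‖u z.1 z.2‖ₑ ^ (10 / 3 : ℝ)) ^ (4 / 5 : ℝ) ≤
        K₂ ^ (4 / 5 : ℝ) * ENNReal.ofReal ((r ^ (5 / 3 : ℝ)) ^ (4 / 5 : ℝ)) := by
      calc (∫⁻ z in parabolicCylinder r ((0 : ℝ), x₀), ‖u z.1 z.2‖ₑ ^ (10 / 3 : ℝ)) ^ (4 / 5 : ℝ)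
          ≤ (K₂ * ENNReal.ofReal (r ^ (5 / 3 : ℝ))) ^ (4 / 5 : ℝ) :=
            ENNReal.rpow_le_rpow (h103 r hr) (by norm_num)
        _ = K₂ ^ (4 / 5 : ℝ) * ENNReal.ofReal ((r ^ (5 / 3 : ℝ)) ^ (4 / 5 : ℝ)) := by
            rw [ENNReal.mul_rpow_of_nonneg _ _ (by norm_num),
              ENNReal.ofReal_rpow_of_nonneg (by positivity) (by norm_num)]
    have hV : volume (ball x₀ r) = ENNReal.ofReal (r ^ 3 * V₁) := by
      rw [Measure.addHaar_ball_of_pos volume x₀ hr0, finrank_euclideanSpace_fin,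
        ENNReal.ofReal_mul (by positivity), ENNReal.ofReal_toReal (measure_ball_lt_top).ne]
    have h3 : (volume (ball x₀ r) * ENNReal.ofReal ((r ^ 2) ^ (1 - μ) / (1 - μ))) ^ δ =
        ENNReal.ofReal ((V₁ / (1 - μ)) ^ δ) * ENNReal.ofReal ((r ^ 3 * (r ^ 2) ^ (1 - μ)) ^ δ) := by
      rw [hV, ← ENNReal.ofReal_mul (by positivity),
        ENNReal.ofReal_rpow_of_nonneg (by positivity) hδ0.le,
        show r ^ 3 * V₁ * ((r ^ 2) ^ (1 - μ) / (1 - μ)) = (V₁ / (1 - μ)) * (r ^ 3 * (r ^ 2) ^ (1 - μ)) by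
          field_simp,
        Real.mul_rpow (by positivity) (by positivity), ENNReal.ofReal_mul (by positivity)]
    -- the powers of `r` add up to `r²`
    have hrr : ENNReal.ofReal ((r ^ (5 / 3 : ℝ)) ^ (4 / 5 : ℝ)) *
        ENNReal.ofReal ((r ^ 3 * (r ^ 2) ^ (1 - μ)) ^ δ) = ENNReal.ofReal r ^ 2 := by
      rw [← ENNReal.ofReal_mul (by positivity), hμ, hδ, cubic_exponent_identity_tenThirds hq hr0,
        ENNReal.ofReal_pow hr0.le]
    have hr0' : ENNReal.ofReal r ≠ 0 := (ENNReal.ofReal_pos.2 hr0).ne'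
    have hcancel : (ENNReal.ofReal r ^ 2)⁻¹ * ENNReal.ofReal r ^ 2 = 1 :=
      ENNReal.inv_mul_cancel (pow_ne_zero _ hr0') (ENNReal.pow_ne_top ENNReal.ofReal_ne_top)
    rw [cknC]
    calc (ENNReal.ofReal r ^ 2)⁻¹ * ∫⁻ z in parabolicCylinder r ((0 : ℝ), x₀), ‖u z.1 z.2‖ₑ ^ (3 : ℕ)
        ≤ (ENNReal.ofReal r ^ 2)⁻¹ * ((∫⁻ z in parabolicCylinder r ((0 : ℝ), x₀), F z) ^ α *
            (K₂ ^ (4 / 5 : ℝ) * ENNReal.ofReal ((r ^ (5 / 3 : ℝ)) ^ (4 / 5 : ℝ))) *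
            (ENNReal.ofReal ((V₁ / (1 - μ)) ^ δ) *
              ENNReal.ofReal ((r ^ 3 * (r ^ 2) ^ (1 - μ)) ^ δ))) := by
          rw [← h3]
          refine mul_le_mul' le_rfl (key.trans ?_)
          gcongr
      _ = Kc * (∫⁻ z in parabolicCylinder r ((0 : ℝ), x₀), F z) ^ α *
            ((ENNReal.ofReal r ^ 2)⁻¹ * (ENNReal.ofReal ((r ^ (5 / 3 : ℝ)) ^ (4 / 5 : ℝ)) *
              ENNReal.ofReal ((r ^ 3 * (r ^ 2) ^ (1 - μ)) ^ δ))) := by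
          rw [hKc]; ring
      _ = Kc * (∫⁻ z in parabolicCylinder r ((0 : ℝ), x₀), F z) ^ α := by
          rw [hrr, hcancel, mul_one]
  -- conclude
  have hlim : Tendsto (fun r : ℝ => Kc *
      (∫⁻ z in parabolicCylinder r ((0 : ℝ), x₀), F z) ^ α) (𝓝[>] 0) (𝓝 0) := by
    have h1 : Tendsto (fun r : ℝ => (∫⁻ z in parabolicCylinder r ((0 : ℝ), x₀), F z) ^ α)
        (𝓝[>] 0) (𝓝 0) := by
      have := ((ENNReal.continuous_rpow_const (y := α)).tendsto 0).comp hI'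
      rwa [ENNReal.zero_rpow_of_pos hα0] at this
    have := ENNReal.Tendsto.const_mul (a := Kc) h1 (Or.inr hKct)
    rwa [mul_zero] at this
  refine tendsto_of_tendsto_of_tendsto_of_le_of_le' tendsto_const_nhds hlim
    (Eventually.of_forall fun r => zero_le) ?_
  filter_upwards [Ioc_mem_nhdsGT hρ] with r hr using hbound r hr

end CubicAllQ

end ChaeWolfDecay

end Literature.Analysis.FluidPDE

end
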